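import Summits.MatrixMultiplication.MatrixMultiplication.Theorems.DesignFlatteningSeparableExit
import Summits.MatrixMultiplication.MatrixMultiplication.Theorems.DesignFlatteningGrowingHostDesignsStubCanonicalHost

/-!
# Crux `GrowingHostDesigns` (stmt-MatrixMultiplication-8033) — `Lines/birth.lean`, the BC3 birth skeleton

Route `DesignFlattening`, target crux #0 `GrowingHostDesigns` (X itself: for every `η > 0` a punctured
abelian host `(G, P)` of `p ⊙ ⟨m,m,m⟩` on the nose and a completion `S` of the `N`-th power of the
punctured table relative to `U_G^{⊗N}` with `|G|^N · R(S) ≤ (p · m^{2+η})^N`).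

THE LINE (the route's own declared exit, header § Two-layer plan: "if `SingleBlockSeparableFloor` is
REFUTED by an explicit family, `GrowingHostDesigns` closes proved via `SeparableExit`"), made into a
two-stub skeleton over ONE explicit family — the TIGHT SQUARE HOST:

* host `G_m := ZMod m × ZMod m` (`|G_m| = m²`, the minimum: on-the-nose hosting forces the output map
  `α` to be injective), kept set `P_m := {(b, c) ∈ G_m × G_m | b.2 + c.1 = 0}` (the anti-diagonal
  coupling of the inner index), so the punctured table is
  `T_m(a; b, c) = [b + c = a ∧ b₂ + c₁ = 0]`; with `b = (κ' + μ, μ)`, `c = (−μ', ν' − μ')`,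
  `a = (κ, ν)` one has `T_m = [μ = μ'] · [κ = κ'] · [ν = ν']`, i.e. `T_m ≅ ⟨m,m,m⟩` EXACTLY (all three
  index maps are bijections `[m]² → G_m`; Cohn–Umans form `A(κ) = (κ,0)`, `C(ν) = (0,ν)`,
  `u(μ) = (μ, μ)`: the triple factorisation `G = A ⊕ C = A ⊕ U = C ⊕ (−U)` of `ℤ_m²`).

* `stub_canonicalHost` (M, provable now) — the three explicit maps host `⟨m,m,m⟩` on the nose in
  `(G_m, P_m)` (stated existentially over the maps, exactly in the hypothesis shape of
  `SingleBlockSeparableFloor`).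
* `stub_canonicalSeparableRate` (XL, OPEN — the line's bet) — the SEPARABLE DESIGN RATE of the tight
  square host is sub-polynomial: for every `δ > 0` there are `m ≥ 2`, a power `N` and a separable
  `k`-term toric design `∑ⱼ ⊗ᵢ U_{G_m} ∘ (u_{ji} ⊗ v_{ji} ⊗ w_{ji})` of `T_m^{⊗N}` with
  `|G_m|^N · k = m^{2N} · k < (m^{2+δ})^N`.  This is `¬ SingleBlockSeparableFloor` WITNESSED BY THE
  CANONICAL FAMILY (strictly stronger than `¬` crux #3, which may pick any host): why this transfer is
  the right first line — (i) the host is explicit and wastes nothing (`T_m ≅ ⟨m,m,m⟩`, `|G| = m²`), so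
  the whole exponent gap `ω − 2` sits in ONE number, the separable design rate
  `σ(m) := lim_N k_N(m)^{1/N} ∈ [1, k_1(m)]` with `k_1(m) ≤ m` (the trivial design
  `[b₂ + c₁ = 0] = Σ_s [b₂ = s][c₁ = −s]`) and `k_1(m) ≥ R(⟨m,m,m⟩)/m² ≥ 3 − o(1)`; the stub says
  `inf_m log σ(m) / log m = 0`; (ii) it is the route's own object (design numbers of powers of a
  punctured table), so the determinant / hexagon-move flattenings of supports `SeparableTorusFloor`,
  `WeylSeparableFloor` apply verbatim and decide small cases (`k_N(2)`, `k_N(3)` for `N ≤ 3` are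
  ALS / Gröbner jobs of the size already run in the route folder); (iii) its negation for this one
  family, `∃ δ > 0 ∀ m N k …, m^{2N} k ≥ m^{(2+δ)N}`, is the sharpest special case of crux #3 and the
  natural first target for the "ManyMovesFlattening" tool the header asks for — either outcome moves
  the route.  Cheapest falsifier: `k_2(2) = 4 ∧ k_3(2) = 8` together with a flattening of ratio `2`
  per copy on `P_2` (then `σ(2) = 2 = m`, no gain at `m = 2`; repeat at `m = 3, 4` — `k_1(4) = 3`
  would read the 2025 record `R⟨4,4,4⟩ ≤ 48 = 16 · 3`).
  Nearest items: this route's `SingleBlockSeparableFloor` (stmt-8035, its negation specialised) and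
  `SeparableExit` (stmt-8041, PROVED, used below by name); route WindowedCompletionRank's
  `WindowCompletion` (stmt-5495) is the ENTANGLED single-copy analogue over arbitrary hosts (every
  `p = 1` instance of X is one of its instances over `G^N`); its negative crux `WindowSqrtBarrier`
  (stmt-5493, open: `n³ ≤ |G| · R(S)²`) would kill this stub (`R(S) ≥ m^{N/2}`) — that is the bet,
  recorded.  Disproof used: no `Disproof.lean` / `Negative/` lemma exists for this crux (crux dir empty
  at registration); negatives index (7 entries) contains nothing on punctured hosts — the route's own
  refuted ex-#4 `SeparableDesignsMultiplicative` concerns the FIXED `ℤ₃` host and is not an instance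
  of either stub.

`GrowingHostDesigns_of` composes the two stubs into the crux BY NAME with a real proof: the stubs
contradict `SingleBlockSeparableFloor` at `δ`, and the route's proved glue `separableExit_proof`
(`¬ SingleBlockSeparableFloor → GrowingHostDesigns`) finishes.  `closed = false` only through the two
`stub_*`.
-/

set_option linter.dupNamespace false

namespace Summit.MatrixMultiplication.MatrixMultiplication.Cruxes.GrowingHostDesigns.Birth

open Summit.MatrixMultiplication.MatrixMultiplication.Theses.DesignFlattening
open Literature.Computability.AlgebraicComplexity
open scoped BigOperators

/-- STUB 1 — the tight square host (provable now, size M).  For every `m ≥ 1` there are index maps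
`α β γ : [m]² → ℤ_m²` hosting `⟨m,m,m⟩` ON THE NOSE in the punctured table
`[b + c = a ∧ b₂ + c₁ = 0]` of `G_m = ℤ_m × ℤ_m`; witnesses: `α(κ,ν) = (κ,ν)`,
`β(κ',μ) = (κ'+μ, μ)`, `γ(μ',ν') = (−μ', ν'−μ')` (then `(βy)₂ + (γz)₁ = μ − μ'` and, given `μ = μ'`,
`βy + γz = (κ', ν')`; injectivity of `Fin m → ZMod m` does the rest). -/
theorem stub_canonicalHost :
    ∀ (m : ℕ) [NeZero m], ∃ α β γ : Fin m × Fin m → ZMod m × ZMod m, ∀ x y z : Fin m × Fin m,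
      matMulTensor ℂ m m m x y z =
        (if β y + γ z = α x ∧ (β y, γ z) ∈
            (Finset.univ.filter fun bc : (ZMod m × ZMod m) × (ZMod m × ZMod m) =>
              bc.1.2 + bc.2.1 = 0)
          then (1 : ℂ) else 0) :=
  -- CLOSED (wave 1, p172451): `Theorems/DesignFlatteningGrowingHostDesignsStubCanonicalHost.lean`
  fun m _ => Summit.MatrixMultiplication.MatrixMultiplication.Theorems.stub_canonicalHost m

/-- STUB 2 — sub-polynomial separable design rate of the tight square host (OPEN; the line's bet, size XL).
For every `δ > 0` there are `m ≥ 2`, `N`, `k` and a separable `k`-term toric design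
`T_m^{⊗N}(a;b,c) = ∑ⱼ ∏ᵢ [bᵢ + cᵢ = aᵢ] · u_{ji}(aᵢ) v_{ji}(bᵢ) w_{ji}(cᵢ)` of the `N`-th power of the
punctured table `T_m = [b + c = a ∧ b₂ + c₁ = 0]` on `ℤ_m²` with `|ℤ_m²|^N · k < (m^{2+δ})^N`, i.e.
`k < m^{δN}`.  (`N ≥ 1` is automatic: at `N = 0` the inequality forces `k = 0`, impossible.)  The
negation of `SingleBlockSeparableFloor` witnessed by ONE explicit family; see the module docstring for
why this family, the numbers `3 − o(1) ≤ k_1(m) ≤ m`, and the cheapest falsifier. -/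
theorem stub_canonicalSeparableRate :
    ∀ δ : ℝ, 0 < δ → ∃ (m : ℕ) (_ : NeZero m), 2 ≤ m ∧
      ∃ (N k : ℕ) (u v w : Fin k → Fin N → ZMod m × ZMod m → ℂ),
        (∀ a b c : Fin N → ZMod m × ZMod m,
          kroneckerPow (fun a b c : ZMod m × ZMod m =>
              if b + c = a ∧ (b, c) ∈
                  (Finset.univ.filter fun bc : (ZMod m × ZMod m) × (ZMod m × ZMod m) =>
                    bc.1.2 + bc.2.1 = 0)
              then (1 : ℂ) else 0) N a b c =
            ∑ j, ∏ i, ((if b i + c i = a i then (1 : ℂ) else 0) *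
              u j i (a i) * v j i (b i) * w j i (c i))) ∧
        (Fintype.card (ZMod m × ZMod m) : ℝ) ^ N * (k : ℝ) < ((m : ℝ) ^ (2 + δ)) ^ N := by
  sorry

/-- COMPOSITION (real proof, no `sorry` of its own): the two stubs contradict
`SingleBlockSeparableFloor` at its own `δ` (instantiate the floor at the tight square host of
`stub_canonicalHost` and the design of `stub_canonicalSeparableRate`), and the route's PROVED glue
`separableExit_proof : ¬ SingleBlockSeparableFloor → GrowingHostDesigns` gives the crux BY NAME. -/
theorem GrowingHostDesigns_of
    (hHost : ∀ (m : ℕ) [NeZero m], ∃ α β γ : Fin m × Fin m → ZMod m × ZMod m,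
      ∀ x y z : Fin m × Fin m,
        matMulTensor ℂ m m m x y z =
          (if β y + γ z = α x ∧ (β y, γ z) ∈
              (Finset.univ.filter fun bc : (ZMod m × ZMod m) × (ZMod m × ZMod m) =>
                bc.1.2 + bc.2.1 = 0)
            then (1 : ℂ) else 0))
    (hRate : ∀ δ : ℝ, 0 < δ → ∃ (m : ℕ) (_ : NeZero m), 2 ≤ m ∧
      ∃ (N k : ℕ) (u v w : Fin k → Fin N → ZMod m × ZMod m → ℂ),
        (∀ a b c : Fin N → ZMod m × ZMod m,
          kroneckerPow (fun a b c : ZMod m × ZMod m =>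
              if b + c = a ∧ (b, c) ∈
                  (Finset.univ.filter fun bc : (ZMod m × ZMod m) × (ZMod m × ZMod m) =>
                    bc.1.2 + bc.2.1 = 0)
              then (1 : ℂ) else 0) N a b c =
            ∑ j, ∏ i, ((if b i + c i = a i then (1 : ℂ) else 0) *
              u j i (a i) * v j i (b i) * w j i (c i))) ∧
        (Fintype.card (ZMod m × ZMod m) : ℝ) ^ N * (k : ℝ) < ((m : ℝ) ^ (2 + δ)) ^ N) :
    GrowingHostDesigns := by
  refine (show ¬ SingleBlockSeparableFloor → GrowingHostDesigns from
    Summit.MatrixMultiplication.MatrixMultiplication.Theorems.separableExit_proof) ?_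
  rintro ⟨δ, hδ, hfloor⟩
  obtain ⟨m, hmz, hm, N, k, u, v, w, hdes, hlt⟩ := hRate δ hδ
  obtain ⟨α, β, γ, hhost⟩ := hHost m
  have hle := hfloor (ZMod m × ZMod m) _ m α β γ hm hhost N k u v w hdes
  exact absurd hle (not_le.mpr hlt)

/-- The crux from the two registered stubs (sorry-dependence only through `stub_*`). -/
theorem GrowingHostDesigns_of_stubs : GrowingHostDesigns :=
  GrowingHostDesigns_of (fun m _ => stub_canonicalHost m) stub_canonicalSeparableRate

end Summit.MatrixMultiplication.MatrixMultiplication.Cruxes.GrowingHostDesigns.Birth
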